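import Summits.BirchSwinnertonDyer.BirchSwinnertonDyer.Theorems.ClassRecordThreeShimuraKolyvaginOrderBoundAtThreeSurjTransport
import HarnessLib

/-!
# The ¬Surj ∧ Irr record stub `stub_orderBound_irredNonSurjAtThree` of crux 19616 reduces to the
# ∃-shape of the Heegner-point bound (JSW Thm 4.4.1, conjunct 4) — the same proof cut as 19899's v3
# (cell `bsd-stepL`, seat `bsd-stepL-shim3b` g4; helper for the record item
# stmt-BirchSwinnertonDyer-19616 `ShimuraKolyvaginOrderBoundAtThree`)

HONEST FRAMING (programme file §HONESTY, verbatim): «no tranche here proves BSD; ARM L moves the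
LITERAL column of an r ≤ 1 census into the kernel-proved-modulo-named-print column; ARM P changes what
«named print» is worth. The residue (4.31 %) and every SUMMIT-BEARING rung (S0–S3) stay theorem-bound
and are staffed by the 22 routes, not by this programme.» THEOREMS ONLY (no definition, no named fact,
no `sorry`); nothing here is a BSD class theorem; no census label moves; item 19616 stays ASIDE and
its stub is NOT claimed (`--as helper`).

## What this file does

Planner g27's skeleton v3 of the D7 successor 19899 (`ShimuraKolyvaginOrderBoundAtThreeSurj`) cuts
the `Surj` half of the old crux 19616 as H (`stub_orderBoundSurj_heegnerPointAtThree`: ONE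
Gross–Zagier-displayed point of `X_{N⁺,N⁻}` carrying Kolyvagin's order bound — the literal ∃-shape of
conjunct 4 of `shimuraCurve_heegnerPoint_grossZagier_kolyvagin` = JSW 2017 Thm 4.4.1, NOT PRINTED at
`3 ∣ N⁺`, `N⁻ > 1`) + T (the rank-one transport, image-free, LANDED fact-free by seat shim-p2 g4,
`ShimuraKolyvaginSurjTransport.card_sha_primaryComponent_le_of_two_displays_anyRank`, p477989).
This file records that **the same cut applies verbatim to the ¬Surj ∧ Irr record stub (7)**:

* `stub_orderBound_irredNonSurjAtThree_of_heegnerPoint` — the REGISTERED signature of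
  `stub_orderBound_irredNonSurjAtThree` (skeleton v5 84b6142d of item 19616), VERBATIM, follows from
  its H-shape `H¬Surj` (the ∃-display-with-bound statement on the slice `¬ Surj W 3`, `Irr`): T is
  image-free (shim-p2's `…_anyRank` + `displayConstant_ne_zero`).

Together with this seat's `ShimuraKolyvaginImageInputs.kolyvaginImageInputs_three` and
`ShimuraKolyvaginCebotarevOfImage.McCallum1991_cor_3_2_pow_three_of_irr` (the Čebotarev step of the
tree's order machine, unconditional at `p = 3` for every irreducible `E[3]`), the record half has NO
residual content beyond the Surj half's: both are «H at their image», and JSW Thm 4.4.1's printed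
hypothesis is `E[p]` irreducible — image-agnostic.  No order bound is proved here.

References: [JetchevSkinnerWan2017] Thm. 4.4.1; [CaiShuTian2014] Thm. 1.5; [SilvermanAEC2009]
VIII.6.7, VIII.9.3.
-/

set_option autoImplicit false
set_option linter.dupNamespace false -- the Theorems namespace repeats the summit name, as in every sibling

noncomputable section

open scoped Classical

namespace Summit.BirchSwinnertonDyer.BirchSwinnertonDyer.Theorems.ShimuraKolyvaginNonSurjCut

open WeierstrassCurve NumberField CongruenceSubgroup Literature.NumberTheory.Automorphic
  Literature.NumberTheory.EllipticCurves.ModularForms Literature.NumberTheory.EllipticCurves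
  Summit.BirchSwinnertonDyer.BirchSwinnertonDyer.Theorems.ShimuraKolyvaginSurjTransport

/-- **Stub (7) `stub_orderBound_irredNonSurjAtThree` of crux 19616 (skeleton v5 84b6142d) — REGISTERED
SIGNATURE VERBATIM as conclusion — follows from its H-shape**: if on the slice `¬ Surj W 3` (and the
stub's other binders) some Gross–Zagier-displayed point `P₁` (`L′(E/K,1) = c_GZ · ĥ(P₁)/degS₁`,
`ord₃ degS₁ = ord₃ deg P₀`) carries Kolyvagin's bound `#Ш(E/K)[3^∞] ≤ 3^(2·ord₃[E(K):ℤP₁])` when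
non-torsion — the ∃-shape of conjunct 4 of `shimuraCurve_heegnerPoint_grossZagier_kolyvagin` (JSW 2017
Thm 4.4.1 / CST 2014 Thm 1.5; printed hypothesis: `E[p]` irreducible) — then EVERY displayed
non-torsion `P` carries it: the image-free transport of seat shim-p2
(`card_sha_primaryComponent_le_of_two_displays_anyRank`, `displayConstant_ne_zero`). The 19899 v3 cut
H + T, verbatim on the record half. [cite: JetchevSkinnerWan2017, Thm. 4.4.1]
[cite: SilvermanAEC2009, Thm. VIII.6.7 and Thm. VIII.9.3] -/
theorem stub_orderBound_irredNonSurjAtThree_of_heegnerPoint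
    (hH : ∀ (W : WeierstrassCurve ℚ) [W.IsElliptic] [W.IsGloballyMinimal] (p : ℕ) [Fact p.Prime]
      (N : ℕ) [NeZero N] (K : Type) [Field K] [NumberField K] (S : Finset ℕ)
      (Dt : ModularParametrizationData W N)
      (X : ShimuraCurveData (∏ q ∈ S, q) (N / ∏ q ∈ S, q))
      (W' : WeierstrassCurve ℚ) [W'.IsElliptic] (P₀ : ShimuraParametrizationData X W'),
      W.conductorNorm ℤ = N → ¬ Literature.NumberTheory.EllipticCurves.Rank1Residual.Surj W 3 →
      p ≠ 2 → W.HasIrreducibleModPGaloisRep p →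
      IsImaginaryQuadratic K → Even S.card →
      (∀ ℓ ∈ S, ℓ.Prime ∧ ℓ ∣ N ∧ ¬ ℓ ^ 2 ∣ N ∧
        ((Ideal.span {(ℓ : ℤ)}).primesOver (𝓞 K)).ncard = 1 ∧ ¬ (ℓ : ℤ) ∣ NumberField.discr K) →
      (∀ ℓ : ℕ, ℓ.Prime → ℓ ∣ N → ℓ ∉ S → ((Ideal.span {(ℓ : ℤ)}).primesOver (𝓞 K)).ncard = 2) →
      ((Ideal.span {(p : ℤ)}).primesOver (𝓞 K)).ncard = 2 →
      P₀.IsMinimalFor W →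
      p ∣ N → p = 3 →
      ∃ (P : (W.baseChange K).toAffine.Point) (degS : ℕ), 0 < degS ∧
        padicValNat p degS = padicValNat p P₀.deg ∧
        LDerivEK W K =
            8 * (Real.pi : ℂ) ^ 2 * peterssonProduct (Gamma0 N) 2 Dt.f Dt.f /
                ((((Units.torsionOrder K : ℝ) / 2) ^ 2 * √|(NumberField.discr K : ℝ)| : ℝ) : ℂ) *
              ((P.canonicalHeight : ℂ) / (degS : ℂ)) ∧
        (¬ IsOfFinAddOrder P →
          Nat.card (AddCommGroup.primaryComponent (W.baseChange K).sha p) ≤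
              p ^ (2 * padicValNat p (AddSubgroup.zmultiples P).index))) :
  ∀ (W : WeierstrassCurve ℚ) [W.IsElliptic] [W.IsGloballyMinimal] (p : ℕ) [Fact p.Prime]
    (N : ℕ) [NeZero N] (K : Type) [Field K] [NumberField K] (S : Finset ℕ)
    (Dt : ModularParametrizationData W N)
    (X : ShimuraCurveData (∏ q ∈ S, q) (N / ∏ q ∈ S, q))
    (W' : WeierstrassCurve ℚ) [W'.IsElliptic] (P₀ : ShimuraParametrizationData X W'),
    W.conductorNorm ℤ = N → ¬ Literature.NumberTheory.EllipticCurves.Rank1Residual.Surj W 3 → p ≠ 2 → W.HasIrreducibleModPGaloisRep p →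
    IsImaginaryQuadratic K → Even S.card →
    (∀ ℓ ∈ S, ℓ.Prime ∧ ℓ ∣ N ∧ ¬ ℓ ^ 2 ∣ N ∧
      ((Ideal.span {(ℓ : ℤ)}).primesOver (𝓞 K)).ncard = 1 ∧ ¬ (ℓ : ℤ) ∣ NumberField.discr K) →
    (∀ ℓ : ℕ, ℓ.Prime → ℓ ∣ N → ℓ ∉ S → ((Ideal.span {(ℓ : ℤ)}).primesOver (𝓞 K)).ncard = 2) →
    ((Ideal.span {(p : ℤ)}).primesOver (𝓞 K)).ncard = 2 →
    P₀.IsMinimalFor W →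
    p ∣ N → p = 3 →
    ∀ (P : (W.baseChange K).toAffine.Point) (degS : ℕ), 0 < degS →
      padicValNat p degS = padicValNat p P₀.deg →
      LDerivEK W K =
        8 * (Real.pi : ℂ) ^ 2 * peterssonProduct (Gamma0 N) 2 Dt.f Dt.f /
            ((((Units.torsionOrder K : ℝ) / 2) ^ 2 * √|(NumberField.discr K : ℝ)| : ℝ) : ℂ) *
          ((P.canonicalHeight : ℂ) / (degS : ℂ)) →
      ¬ IsOfFinAddOrder P →
        Nat.card (AddCommGroup.primaryComponent (W.baseChange K).sha p) ≤
          p ^ (2 * padicValNat p (AddSubgroup.zmultiples P).index) := by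
  intro W _ _ p _ N _ K _ _ S Dt X W' _ P₀ hN hns hp2 hirr hK hS hin hsp hps hmin hpN hp3 P degS hdegS
    hval hdisp hPnt
  obtain ⟨P₁, degS₁, h0₁, hv₁, hdisp₁, hB₁⟩ :=
    hH W p N K S Dt X W' P₀ hN hns hp2 hirr hK hS hin hsp hps hmin hpN hp3
  exact card_sha_primaryComponent_le_of_two_displays_anyRank W K (Fact.out)
    (displayConstant_ne_zero Dt K) h0₁ hdegS (hv₁.trans hval.symm) hdisp₁ hdisp hPnt hB₁

end Summit.BirchSwinnertonDyer.BirchSwinnertonDyer.Theorems.ShimuraKolyvaginNonSurjCut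

end
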